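import Literature.AnabelianGeometry.SemiGraphs.TemperedCompactPairBridgeOpen
import HarnessLib

/-!
# Two compact subgroups of `π₁^temp(𝒢)`: the EXACT compactness criterion for the subgroup they generate,
# the LEVEL-RELATIVE edge certificate, and the persistence of fixed edges over ONE level edge

Mochizuki, *Semi-graphs of anabelioids*, Publ. RIMS **42** (2006), §1, Lemma 1.8 (ii) p. 20 ("`Γ` acts
trivially on any 'geodesic' [i.e., path of closed edges of minimal length] that joins `w₁`, `w₂`" — print's
`G`, `w₁`, `w₂` adapted), §3, Theorem 3.7 (iii)/(iv) pp. 40–41 [cite: MochizukiSemiAnbd2006, Thm 3.7(iv) p.41].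

PROOF-ONLY tool file (abc-iut cell, layer L3, row «T37iv-S2@RELATIVE-BRIDGE», seat abc-iut-L3-t8 gen 10; no
definition, no named fact).  Sharpening of this lineage's two-level bridge
(`TemperedCompactPairBridgeOpen.lean`, gen 9): there, two compact `K₁, K₂ ≤ π₁^temp(𝒢)` sharing an element `d`
with a certificate over BASE edges («for every edge `n` of `𝔾`, from some level on `d` fixes no edge of
`𝒢_{∞,M}` over `n`») generate a compact subgroup.  The proof in fact produces, from a separating edge `e₀` of the
LEVEL tree `𝒢_{∞,m}`, a `d`-fixed edge of `𝒢_{∞,M}` over `e₀` ITSELF at every `M ≥ m` — so the certificate is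
only needed RELATIVE TO LEVEL EDGES, and the obstruction to compactness is a «relative persistent type».  For ANY
countable semi-graph of anabelioids `𝒢` satisfying the hypotheses of Prop. 3.6, in the canonical tower `𝒢_{∞,n}`:

* `isCompact_topologicalClosure_sup_of_forall_exists_common_fixed_vertex`,
  `exists_common_fixed_vertex_of_isCompact_topologicalClosure_sup`, `isCompact_topologicalClosure_sup_iff` —
  the EXACT CRITERION: for subgroups `K₁, K₂ ≤ π₁^temp(𝒢)`, `(K₁ ⊔ K₂)‾` is compact iff at EVERY level `K₁` and
  `K₂` fix a common vertex of `𝒢_{∞,m}` (no compactness of `K₁`, `K₂` needed for «⇐»);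
* `exists_fixed_edge_over_on_path_of_forall_not_common_fixed` — PERSISTENCE: if compact `K₁, K₂ ∋ d` fix no
  common vertex of `𝒢_{∞,m}`, there is an edge `e₀` of `𝒢_{∞,m}`, fixed by `d`, such that at EVERY level `M ≥ m`
  EVERY path of `𝒢_{∞,M}` from a `K₁`-fixed vertex to a `K₂`-fixed vertex passes through a `d`-FIXED edge lying
  OVER `e₀`;
* `exists_common_fixed_vertex_of_relCertificate`, `isCompact_topologicalClosure_sup_of_relCertificate`,
  `le_of_isMaximalCompactSubgroup_of_relCertificate` — the bridge under the LEVEL-RELATIVE certificate «for every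
  level `m` and every `d`-fixed edge `e₀` of `𝒢_{∞,m}` there is a level `M ≥ m` at which `d` fixes no edge of
  `𝒢_{∞,M}` over `e₀`»; `relCertificate_of_certificate` — the base-edge certificate of gen 9 implies it;
* `exists_persistent_level_edge_of_not_isCompact` — contrapositive: if `(K₁ ⊔ K₂)‾` is NOT compact, some
  `d`-fixed level edge `e₀` carries a `d`-fixed edge of `𝒢_{∞,M}` over it at every `M ≥ m`, on the geodesic
  between any `K₁`-fixed and any `K₂`-fixed vertex.

Honest framing: generic statements about OUR typed `π₁^temp` (canonical chart); nothing here bears on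
[IUTchIII] Cor. 3.12; no side taken; typed ≠ proved elsewhere.
-/
noncomputable section

open CategoryTheory Topology

namespace Literature.AnabelianGeometry.SemiGraphs

open SimpleGraph

universe u

namespace ProfiniteSemiGraph

variable {𝒢 : ProfiniteSemiGraph.{u}}

/-! ### The exact criterion: common fixed vertices at every level -/

/-- **The closed subgroup generated by two subgroups fixing a common vertex at every level is COMPACT**: its
level images lie in vertex-stabiliser images (abc-iut-L3-t6's `fixes_vertex_iff_exists_gal`), which are finite,
and a closed subgroup of `π₁^temp(𝒢) = lim_n Gal(𝒢_{∞,n}/𝒢)` with finite level images is compact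
(`isCompact_of_isClosed_of_forall_finite_image`).  No compactness of `K₁`, `K₂` is assumed.
[cite: MochizukiSemiAnbd2006, Thm 3.7(iii) p.41] -/
theorem isCompact_topologicalClosure_sup_of_forall_exists_common_fixed_vertex (h36 : 𝒢.Prop36Hypotheses)
    (K₁ K₂ : Subgroup ((𝒢.galoisLevelData h36).temperedPi h36.isCountable))
    (hz : ∀ m : ℕ, ∃ z : ((𝒢.galoisLevelData h36).tree m).Vertex,
      (∀ k ∈ K₁, ((𝒢.galoisLevelData h36).treeAct h36.isCountable m k).hom.vertexMap z = z) ∧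
      ∀ k ∈ K₂, ((𝒢.galoisLevelData h36).treeAct h36.isCountable m k).hom.vertexMap z = z) :
    IsCompact (((K₁ ⊔ K₂).topologicalClosure :
      Subgroup ((𝒢.galoisLevelData h36).temperedPi h36.isCountable)) :
        Set ((𝒢.galoisLevelData h36).temperedPi h36.isCountable)) := by
  classical
  let Dg := 𝒢.galoisLevelData h36
  have hc := h36.isCountable
  let K' : Subgroup (Dg.temperedPi hc) := (K₁ ⊔ K₂).topologicalClosure
  have hfin : ∀ m, (Dg.proj hc m '' (K' : Set (Dg.temperedPi hc))).Finite := by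
    intro m
    obtain ⟨z, hz₁, hz₂⟩ := hz m
    obtain ⟨T, hT⟩ : ∃ T : Dg.PointSeq hc ((Dg.treeProj m).vertexMap z), T.vertex m = z :=
      exists_pointSeq_vertex_eq_galoisLevelData h36 m z
    -- the finite image `R` of the decomposition group `ψ_T(Π_w)` at level `m`
    let R : Subgroup (Dg.Gal hc m) := (T.decompHom.range).map (Dg.proj hc m)
    have hRfin : (R : Set (Dg.Gal hc m)).Finite := by
      have h2 : IsCompact (Dg.proj hc m '' Set.range T.decompHom) :=
        (isCompact_range T.continuous_decompHom).image (Dg.continuous_proj hc m)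
      have h3 : (R : Set (Dg.Gal hc m)) = Dg.proj hc m '' Set.range T.decompHom := by
        change (((T.decompHom.range).map (Dg.proj hc m) : Subgroup (Dg.Gal hc m)) : Set (Dg.Gal hc m)) = _
        rw [Subgroup.coe_map, MonoidHom.coe_range]
      exact h3 ▸ h2.finite_of_discrete
    have hmemR : ∀ g : Dg.temperedPi hc, (Dg.treeAct hc m g).hom.vertexMap z = z → Dg.proj hc m g ∈ R := by
      intro g hg
      rw [← hT] at hg
      obtain ⟨kk, hkk⟩ := (T.fixes_vertex_iff_exists_gal m g).mp hg
      exact Subgroup.mem_map.mpr ⟨T.decompHom kk, ⟨kk, rfl⟩, (T.proj_decompHom m kk).trans hkk⟩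
    have hle : (K₁ ⊔ K₂).map (Dg.proj hc m) ≤ R := by
      rw [Subgroup.map_le_iff_le_comap]
      refine sup_le (fun x hx => ?_) (fun x hx => ?_)
      · exact hmemR _ (hz₁ x hx)
      · exact hmemR _ (hz₂ x hx)
    refine hRfin.subset ?_
    rintro _ ⟨x, hx, rfl⟩
    have h1 := image_closure_subset_closure_image (Dg.continuous_proj hc m)
      ⟨x, (by rw [← Subgroup.topologicalClosure_coe]; exact hx), rfl⟩
    rw [(isClosed_discrete _).closure_eq] at h1
    obtain ⟨x', hx'', hxx'⟩ := h1
    exact hxx' ▸ hle (Subgroup.mem_map.mpr ⟨x', hx'', rfl⟩)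
  exact Dg.isCompact_of_isClosed_of_forall_finite_image hc (K' : Set (Dg.temperedPi hc))
    (Subgroup.isClosed_topologicalClosure _) hfin

/-- **Conversely, if `(K₁ ⊔ K₂)‾` is compact then `K₁` and `K₂` fix a common vertex at every level** (a compact
subgroup of `π₁^temp(𝒢)` fixes a vertex of every `𝒢_{∞,m}`, and both `K₁`, `K₂` lie in the closure).
[cite: MochizukiSemiAnbd2006, Thm 3.7(iii) p.41] -/
theorem exists_common_fixed_vertex_of_isCompact_topologicalClosure_sup (h36 : 𝒢.Prop36Hypotheses)
    (K₁ K₂ : Subgroup ((𝒢.galoisLevelData h36).temperedPi h36.isCountable))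
    (hK : IsCompact (((K₁ ⊔ K₂).topologicalClosure :
      Subgroup ((𝒢.galoisLevelData h36).temperedPi h36.isCountable)) :
        Set ((𝒢.galoisLevelData h36).temperedPi h36.isCountable)))
    (m : ℕ) :
    ∃ z : ((𝒢.galoisLevelData h36).tree m).Vertex,
      (∀ k ∈ K₁, ((𝒢.galoisLevelData h36).treeAct h36.isCountable m k).hom.vertexMap z = z) ∧
      ∀ k ∈ K₂, ((𝒢.galoisLevelData h36).treeAct h36.isCountable m k).hom.vertexMap z = z := by
  have hc := h36.isCountable
  let D₀ : VerticialLevelData.{0} 𝒢 (𝒢.temperedPiChart h36) := verticialLevelData_temperedPiChart (h36 := h36)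
  obtain ⟨z, hz⟩ := D₀.exists_forall_mem_fixed_vertex_of_isCompact (K₁ ⊔ K₂).topologicalClosure hK m
  have h₁ : K₁ ≤ (K₁ ⊔ K₂).topologicalClosure := le_sup_left.trans (Subgroup.le_topologicalClosure _)
  have h₂ : K₂ ≤ (K₁ ⊔ K₂).topologicalClosure := le_sup_right.trans (Subgroup.le_topologicalClosure _)
  exact ⟨z, fun k hk => hz k (h₁ hk), fun k hk => hz k (h₂ hk)⟩

/-- **EXACT CRITERION**: for subgroups `K₁, K₂ ≤ π₁^temp(𝒢)`, the closed subgroup `(K₁ ⊔ K₂)‾` is compact iff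
at every level `m` the two subgroups fix a COMMON vertex of `𝒢_{∞,m}`. [cite: MochizukiSemiAnbd2006, Thm 3.7(iv) p.41] -/
theorem isCompact_topologicalClosure_sup_iff (h36 : 𝒢.Prop36Hypotheses)
    (K₁ K₂ : Subgroup ((𝒢.galoisLevelData h36).temperedPi h36.isCountable)) :
    IsCompact (((K₁ ⊔ K₂).topologicalClosure :
      Subgroup ((𝒢.galoisLevelData h36).temperedPi h36.isCountable)) :
        Set ((𝒢.galoisLevelData h36).temperedPi h36.isCountable)) ↔
      ∀ m : ℕ, ∃ z : ((𝒢.galoisLevelData h36).tree m).Vertex,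
        (∀ k ∈ K₁, ((𝒢.galoisLevelData h36).treeAct h36.isCountable m k).hom.vertexMap z = z) ∧
        ∀ k ∈ K₂, ((𝒢.galoisLevelData h36).treeAct h36.isCountable m k).hom.vertexMap z = z :=
  ⟨fun h m => exists_common_fixed_vertex_of_isCompact_topologicalClosure_sup h36 K₁ K₂ h m,
    fun h => isCompact_topologicalClosure_sup_of_forall_exists_common_fixed_vertex h36 K₁ K₂ h⟩

/-! ### Persistence: a separating level edge carries fixed edges over it at every deeper level -/

/-- **PERSISTENCE over ONE level edge.**  Let `K₁, K₂ ≤ π₁^temp(𝒢)` be compact with `d ∈ K₁ ⊓ K₂`, and suppose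
that `K₁` and `K₂` fix NO common vertex of `𝒢_{∞,m}`.  Then there is an edge `e₀` of `𝒢_{∞,m}`, fixed by `d`,
such that for EVERY level `M ≥ m`, every `K₁`-fixed vertex `v` and every `K₂`-fixed vertex `w` of `𝒢_{∞,M}`,
EVERY path of the barycentric subdivision from `v` to `w` passes through the edge-point of an edge `ε` which is
FIXED by `d` and lies OVER `e₀`.  (Lemma 1.8 (ii) at level `m` gives `e₀` on every walk from a `K₁`-fixed to a
`K₂`-fixed vertex; a path `[v, w]` of `𝒢_{∞,M}` is fixed node-wise by `d ∈ K₁ ⊓ K₂`, and its image in `𝒢_{∞,m}`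
joins the `K₁`-fixed `π v` to the `K₂`-fixed `π w`, hence passes `e₀`.) [cite: MochizukiSemiAnbd2006, Lem. 1.8(ii)(b) p.20] -/
theorem exists_fixed_edge_over_on_path_of_forall_not_common_fixed (h36 : 𝒢.Prop36Hypotheses)
    (K₁ K₂ : Subgroup ((𝒢.galoisLevelData h36).temperedPi h36.isCountable))
    (hK₁ : IsCompact (K₁ : Set ((𝒢.galoisLevelData h36).temperedPi h36.isCountable)))
    (hK₂ : IsCompact (K₂ : Set ((𝒢.galoisLevelData h36).temperedPi h36.isCountable)))
    {d : (𝒢.galoisLevelData h36).temperedPi h36.isCountable} (hd₁ : d ∈ K₁) (hd₂ : d ∈ K₂) (m : ℕ)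
    (hno : ∀ z : ((𝒢.galoisLevelData h36).tree m).Vertex,
      (∀ k ∈ K₁, ((𝒢.galoisLevelData h36).treeAct h36.isCountable m k).hom.vertexMap z = z) →
        ¬ ∀ k ∈ K₂, ((𝒢.galoisLevelData h36).treeAct h36.isCountable m k).hom.vertexMap z = z) :
    ∃ e₀ : ((𝒢.galoisLevelData h36).tree m).Edge,
      ((𝒢.galoisLevelData h36).treeAct h36.isCountable m d).hom.edgeMap e₀ = e₀ ∧
      ∀ (M : ℕ) (hmM : m ≤ M) (v w : ((𝒢.galoisLevelData h36).tree M).Vertex),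
        (∀ k ∈ K₁, ((𝒢.galoisLevelData h36).treeAct h36.isCountable M k).hom.vertexMap v = v) →
        (∀ k ∈ K₂, ((𝒢.galoisLevelData h36).treeAct h36.isCountable M k).hom.vertexMap w = w) →
        ∀ γ : ((𝒢.galoisLevelData h36).tree M).subdivision.Walk (Sum.inl v) (Sum.inl w), γ.IsPath →
          ∃ ε : ((𝒢.galoisLevelData h36).tree M).Edge,
            (Sum.inr (Sum.inl ε) : ((𝒢.galoisLevelData h36).tree M).Node) ∈ γ.support ∧
            ((𝒢.galoisLevelData h36).treeTrans hmM).edgeMap ε = e₀ ∧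
            ((𝒢.galoisLevelData h36).treeAct h36.isCountable M d).hom.edgeMap ε = ε := by
  classical
  let Dg := 𝒢.galoisLevelData h36
  have hc := h36.isCountable
  let D₀ : VerticialLevelData.{0} 𝒢 (𝒢.temperedPiChart h36) := verticialLevelData_temperedPiChart (h36 := h36)
  -- fixed vertices of `K₁` and of `K₂` at level `m`
  obtain ⟨a₀, ha₀⟩ := D₀.exists_forall_mem_fixed_vertex_of_isCompact K₁ hK₁ m
  obtain ⟨b₀, hb₀⟩ := D₀.exists_forall_mem_fixed_vertex_of_isCompact K₂ hK₂ m
  -- the separating edge `e₀` of level `m` (tree bridge for the two families of level-`m` automorphisms)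
  obtain ⟨e₀, he₀⟩ := SemiGraph.exists_edge_forall_walk_mem_support_of_family' (Dg.isTree_tree m)
    ((fun k => Dg.treeAct hc m k) '' (K₁ : Set (Dg.temperedPi hc)))
    ((fun k => Dg.treeAct hc m k) '' (K₂ : Set (Dg.temperedPi hc)))
    (by
      rintro _ ⟨k, -, rfl⟩ e he β hβ
      exact SemiGraph.branchMap_eq_of_over_aut (Dg.treeProj m) (Dg.treeAct hc m k) (Dg.treeAct_over hc m k) β
        (by rw [hβ]; exact he))
    (by
      rintro _ ⟨k, -, rfl⟩ e he β hβ
      exact SemiGraph.branchMap_eq_of_over_aut (Dg.treeProj m) (Dg.treeAct hc m k) (Dg.treeAct_over hc m k) β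
        (by rw [hβ]; exact he))
    (a₀ := a₀) (b₀ := b₀)
    (by rintro _ ⟨k, hk, rfl⟩; exact ha₀ k hk) (by rintro _ ⟨k, hk, rfl⟩; exact hb₀ k hk)
    (by
      intro z hz hz'
      exact hno z (fun k hk => hz _ ⟨k, hk, rfl⟩) (fun k hk => hz' _ ⟨k, hk, rfl⟩))
  -- the main claim: at every level `M ≥ m`, every path `[v, w]` passes a `d`-fixed edge over `e₀`
  have key : ∀ (M : ℕ) (hmM : m ≤ M) (v w : (Dg.tree M).Vertex),
      (∀ k ∈ K₁, (Dg.treeAct hc M k).hom.vertexMap v = v) →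
      (∀ k ∈ K₂, (Dg.treeAct hc M k).hom.vertexMap w = w) →
      ∀ γ : (Dg.tree M).subdivision.Walk (Sum.inl v) (Sum.inl w), γ.IsPath →
        ∃ ε : (Dg.tree M).Edge, (Sum.inr (Sum.inl ε) : (Dg.tree M).Node) ∈ γ.support ∧
          (Dg.treeTrans hmM).edgeMap ε = e₀ ∧ (Dg.treeAct hc M d).hom.edgeMap ε = ε := by
    intro M hmM v w hv hw γ hγp
    have hvd : (Dg.treeAct hc M d).hom.vertexMap v = v := hv d hd₁
    have hwd : (Dg.treeAct hc M d).hom.vertexMap w = w := hw d hd₂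
    -- the path `[v, w]` of `𝒢_{∞,M}` is fixed node-wise by `d`
    have hγfix : ∀ x ∈ γ.support, SemiGraph.nodeMap (Dg.treeAct hc M d) x = x :=
      SemiGraph.nodeMap_eq_self_of_isPath (Dg.isTree_tree M).isTree.isAcyclic
        (Dg.treeAct hc M d) (by rw [SemiGraph.nodeMap_inl, hvd]) (by rw [SemiGraph.nodeMap_inl, hwd]) γ hγp
    -- push it down to level `m`: a walk from the `K₁`-fixed vertex `π v` to the `K₂`-fixed vertex `π w`
    obtain ⟨ω, hω⟩ := SemiGraph.exists_walk_nodeMap (Dg.treeTrans hmM) γ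
    have hπv : ∀ k ∈ K₁, (Dg.treeAct hc m k).hom.vertexMap ((Dg.treeTrans hmM).vertexMap v) =
        (Dg.treeTrans hmM).vertexMap v := by
      intro k hk
      have hvk : (Dg.treeAct hc M k).hom.vertexMap v = v := hv k hk
      have h : (Dg.treeTrans hmM).vertexMap ((Dg.treeAct hc M k).hom.vertexMap v) =
          (Dg.treeAct hc m k).hom.vertexMap ((Dg.treeTrans hmM).vertexMap v) := D₀.trans_act_vertexMap hmM k v
      rw [hvk] at h
      exact h.symm
    have hπw : ∀ k ∈ K₂, (Dg.treeAct hc m k).hom.vertexMap ((Dg.treeTrans hmM).vertexMap w) =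
        (Dg.treeTrans hmM).vertexMap w := by
      intro k hk
      have hwk : (Dg.treeAct hc M k).hom.vertexMap w = w := hw k hk
      have h : (Dg.treeTrans hmM).vertexMap ((Dg.treeAct hc M k).hom.vertexMap w) =
          (Dg.treeAct hc m k).hom.vertexMap ((Dg.treeTrans hmM).vertexMap w) := D₀.trans_act_vertexMap hmM k w
      rw [hwk] at h
      exact h.symm
    -- the bridge: the image walk passes through the edge-point `e₀`, i.e. some edge `ε` of `[v, w]` lies over `e₀`
    have hmem : (Sum.inr (Sum.inl e₀) : (Dg.tree m).Node) ∈ ω.support :=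
      he₀ _ _ (by rintro _ ⟨k, hk, rfl⟩; exact hπv k hk) (by rintro _ ⟨k, hk, rfl⟩; exact hπw k hk) ω
    rw [hω, List.mem_map] at hmem
    obtain ⟨x, hx, hxe⟩ := hmem
    obtain ⟨ε, rfl, hε⟩ := (SemiGraph.Hom.nodeMap_eq_edge_iff _ x e₀).mp hxe
    -- `ε` is fixed by `d`
    have hεfix : (Dg.treeAct hc M d).hom.edgeMap ε = ε := by
      simpa only [SemiGraph.nodeMap_inr_inl, Sum.inr.injEq, Sum.inl.injEq] using hγfix _ hx
    exact ⟨ε, hx, hε, hεfix⟩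
  refine ⟨e₀, ?_, key⟩
  -- `e₀` itself is fixed by `d`: the level-`m` instance on the geodesic `[a₀, b₀]`
  obtain ⟨γ₀, hγ₀p, -⟩ := ((Dg.isTree_tree m).isTree.connected
    (Sum.inl a₀ : (Dg.tree m).Node) (Sum.inl b₀)).exists_path_of_dist
  obtain ⟨ε, -, hε, hεfix⟩ := key m le_rfl a₀ b₀ ha₀ hb₀ γ₀ hγ₀p
  have hεe : ε = e₀ := by
    rw [← hε, Dg.treeTrans_self]
    rfl
  rw [← hεe]
  exact hεfix

/-! ### The bridge under the level-relative certificate -/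

/-- **TWO-LEVEL BRIDGE, LEVEL-RELATIVE CERTIFICATE.**  Let `K₁, K₂ ≤ π₁^temp(𝒢)` be compact and `d ∈ K₁ ⊓ K₂`.
Suppose that for every `d`-fixed edge `e₀` of `𝒢_{∞,m}` there is a level `M ≥ m` at which `d` fixes NO edge of
`𝒢_{∞,M}` over `e₀`.  Then `K₁` and `K₂` fix a common vertex of `𝒢_{∞,m}`.
[cite: MochizukiSemiAnbd2006, Lem. 1.8(ii)(b) p.20] -/
theorem exists_common_fixed_vertex_of_relCertificate (h36 : 𝒢.Prop36Hypotheses)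
    (K₁ K₂ : Subgroup ((𝒢.galoisLevelData h36).temperedPi h36.isCountable))
    (hK₁ : IsCompact (K₁ : Set ((𝒢.galoisLevelData h36).temperedPi h36.isCountable)))
    (hK₂ : IsCompact (K₂ : Set ((𝒢.galoisLevelData h36).temperedPi h36.isCountable)))
    {d : (𝒢.galoisLevelData h36).temperedPi h36.isCountable} (hd₁ : d ∈ K₁) (hd₂ : d ∈ K₂) (m : ℕ)
    (hcert : ∀ e₀ : ((𝒢.galoisLevelData h36).tree m).Edge,
      ((𝒢.galoisLevelData h36).treeAct h36.isCountable m d).hom.edgeMap e₀ = e₀ →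
        ∃ (M : ℕ) (hmM : m ≤ M), ∀ ε : ((𝒢.galoisLevelData h36).tree M).Edge,
          ((𝒢.galoisLevelData h36).treeTrans hmM).edgeMap ε = e₀ →
            ((𝒢.galoisLevelData h36).treeAct h36.isCountable M d).hom.edgeMap ε ≠ ε) :
    ∃ z : ((𝒢.galoisLevelData h36).tree m).Vertex,
      (∀ k ∈ K₁, ((𝒢.galoisLevelData h36).treeAct h36.isCountable m k).hom.vertexMap z = z) ∧
      ∀ k ∈ K₂, ((𝒢.galoisLevelData h36).treeAct h36.isCountable m k).hom.vertexMap z = z := by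
  classical
  let Dg := 𝒢.galoisLevelData h36
  have hc := h36.isCountable
  let D₀ : VerticialLevelData.{0} 𝒢 (𝒢.temperedPiChart h36) := verticialLevelData_temperedPiChart (h36 := h36)
  by_contra hno
  push Not at hno
  obtain ⟨e₀, he₀d, he₀⟩ := exists_fixed_edge_over_on_path_of_forall_not_common_fixed h36 K₁ K₂ hK₁ hK₂ hd₁ hd₂
    m (fun z hz hz' => by obtain ⟨k, hk, hne⟩ := hno z hz; exact hne (hz' k hk))
  obtain ⟨M, hmM, hM⟩ := hcert e₀ he₀d
  -- at level `M`: a vertex `v` fixed by `K₁`, a vertex `w` fixed by `K₂`, and the geodesic `[v, w]`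
  obtain ⟨v, hv⟩ := D₀.exists_forall_mem_fixed_vertex_of_isCompact K₁ hK₁ M
  obtain ⟨w, hw⟩ := D₀.exists_forall_mem_fixed_vertex_of_isCompact K₂ hK₂ M
  obtain ⟨γ, hγp, -⟩ := ((Dg.isTree_tree M).isTree.connected
    (Sum.inl v : (Dg.tree M).Node) (Sum.inl w)).exists_path_of_dist
  obtain ⟨ε, -, hε, hεfix⟩ := he₀ M hmM v w hv hw γ hγp
  exact hM ε hε hεfix

/-- **The closed subgroup generated by two compact subgroups sharing an element with a LEVEL-RELATIVE
certificate at every level is COMPACT.** [cite: MochizukiSemiAnbd2006, Thm 3.7(iv) p.41] -/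
theorem isCompact_topologicalClosure_sup_of_relCertificate (h36 : 𝒢.Prop36Hypotheses)
    (K₁ K₂ : Subgroup ((𝒢.galoisLevelData h36).temperedPi h36.isCountable))
    (hK₁ : IsCompact (K₁ : Set ((𝒢.galoisLevelData h36).temperedPi h36.isCountable)))
    (hK₂ : IsCompact (K₂ : Set ((𝒢.galoisLevelData h36).temperedPi h36.isCountable)))
    {d : (𝒢.galoisLevelData h36).temperedPi h36.isCountable} (hd₁ : d ∈ K₁) (hd₂ : d ∈ K₂)
    (hcert : ∀ (m : ℕ) (e₀ : ((𝒢.galoisLevelData h36).tree m).Edge),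
      ((𝒢.galoisLevelData h36).treeAct h36.isCountable m d).hom.edgeMap e₀ = e₀ →
        ∃ (M : ℕ) (hmM : m ≤ M), ∀ ε : ((𝒢.galoisLevelData h36).tree M).Edge,
          ((𝒢.galoisLevelData h36).treeTrans hmM).edgeMap ε = e₀ →
            ((𝒢.galoisLevelData h36).treeAct h36.isCountable M d).hom.edgeMap ε ≠ ε) :
    IsCompact (((K₁ ⊔ K₂).topologicalClosure :
      Subgroup ((𝒢.galoisLevelData h36).temperedPi h36.isCountable)) :
        Set ((𝒢.galoisLevelData h36).temperedPi h36.isCountable)) :=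
  isCompact_topologicalClosure_sup_of_forall_exists_common_fixed_vertex h36 K₁ K₂ fun m =>
    exists_common_fixed_vertex_of_relCertificate h36 K₁ K₂ hK₁ hK₂ hd₁ hd₂ m (hcert m)

/-- **A maximal compact subgroup CONTAINS every compact subgroup with which it shares an element carrying a
level-relative certificate**: if `K₂` is a maximal compact subgroup of `π₁^temp(𝒢)`, `K₁` is compact and
`d ∈ K₁ ⊓ K₂` carries a level-relative certificate at every level, then `K₁ ≤ K₂`.
[cite: MochizukiSemiAnbd2006, Thm 3.7(iv) p.41] -/
theorem le_of_isMaximalCompactSubgroup_of_relCertificate (h36 : 𝒢.Prop36Hypotheses)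
    (K₁ K₂ : Subgroup ((𝒢.galoisLevelData h36).temperedPi h36.isCountable))
    (hK₁ : IsCompact (K₁ : Set ((𝒢.galoisLevelData h36).temperedPi h36.isCountable)))
    (hK₂ : IsMaximalCompactSubgroup K₂)
    {d : (𝒢.galoisLevelData h36).temperedPi h36.isCountable} (hd₁ : d ∈ K₁) (hd₂ : d ∈ K₂)
    (hcert : ∀ (m : ℕ) (e₀ : ((𝒢.galoisLevelData h36).tree m).Edge),
      ((𝒢.galoisLevelData h36).treeAct h36.isCountable m d).hom.edgeMap e₀ = e₀ →
        ∃ (M : ℕ) (hmM : m ≤ M), ∀ ε : ((𝒢.galoisLevelData h36).tree M).Edge,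
          ((𝒢.galoisLevelData h36).treeTrans hmM).edgeMap ε = e₀ →
            ((𝒢.galoisLevelData h36).treeAct h36.isCountable M d).hom.edgeMap ε ≠ ε) :
    K₁ ≤ K₂ := by
  have hcpt := isCompact_topologicalClosure_sup_of_relCertificate h36 K₁ K₂ hK₁ hK₂.1 hd₁ hd₂ hcert
  have hle₂ : K₂ ≤ (K₁ ⊔ K₂).topologicalClosure := le_sup_right.trans (Subgroup.le_topologicalClosure _)
  have heq := hK₂.2 _ hcpt hle₂
  exact (le_sup_left.trans (Subgroup.le_topologicalClosure _)).trans heq.le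

/-- **The base-edge certificate implies the level-relative certificate**: if for every base edge `n` there is a
level `M₀` beyond which `d` fixes no edge over `n`, then for every level `m` and every edge `e₀` of `𝒢_{∞,m}` (over
`n`, say) `d` fixes no edge of `𝒢_{∞,max(m, M₀)}` over `e₀` — the transitions of trees lie over `𝔾`.  So the
bridge of `TemperedCompactPairBridgeOpen.lean` is the special case. [cite: MochizukiSemiAnbd2006, Thm 3.7(iii) p.41] -/
theorem relCertificate_of_certificate (h36 : 𝒢.Prop36Hypotheses)
    (d : (𝒢.galoisLevelData h36).temperedPi h36.isCountable)
    (hcert : ∀ n : 𝒢.graph.Edge, ∃ M₀ : ℕ, ∀ M, M₀ ≤ M → ∀ ε : ((𝒢.galoisLevelData h36).tree M).Edge,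
      ((𝒢.galoisLevelData h36).treeProj M).edgeMap ε = n →
        ((𝒢.galoisLevelData h36).treeAct h36.isCountable M d).hom.edgeMap ε ≠ ε)
    (m : ℕ) (e₀ : ((𝒢.galoisLevelData h36).tree m).Edge) :
    ∃ (M : ℕ) (hmM : m ≤ M), ∀ ε : ((𝒢.galoisLevelData h36).tree M).Edge,
      ((𝒢.galoisLevelData h36).treeTrans hmM).edgeMap ε = e₀ →
        ((𝒢.galoisLevelData h36).treeAct h36.isCountable M d).hom.edgeMap ε ≠ ε := by
  obtain ⟨M₀, hM₀⟩ := hcert (((𝒢.galoisLevelData h36).treeProj m).edgeMap e₀)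
  refine ⟨max m M₀, le_max_left _ _, fun ε hε => hM₀ _ (le_max_right _ _) ε ?_⟩
  have h := congrArg (fun φ => SemiGraph.Hom.edgeMap φ ε)
    ((𝒢.galoisLevelData h36).treeTrans_over (le_max_left m M₀))
  simp only [SemiGraph.comp_edgeMap, Function.comp_apply] at h
  rw [hε] at h
  exact h.symm

/-! ### The obstruction: a relative persistent type -/

/-- **If `(K₁ ⊔ K₂)‾` is NOT compact, then some level edge is a RELATIVE PERSISTENT TYPE of every shared element**:
for compact `K₁, K₂ ∋ d` there are a level `m` and a `d`-fixed edge `e₀` of `𝒢_{∞,m}` such that at EVERY level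
`M ≥ m` there is a `d`-fixed edge of `𝒢_{∞,M}` over `e₀` — indeed one on the geodesic between ANY `K₁`-fixed and ANY
`K₂`-fixed vertex of `𝒢_{∞,M}` (`exists_fixed_edge_over_on_path_of_forall_not_common_fixed`).  This is the exact
obstruction any counter-carrier to the second sentence of Thm 3.7 (iv) must realise.
[cite: MochizukiSemiAnbd2006, Thm 3.7(iv) p.41] -/
theorem exists_persistent_level_edge_of_not_isCompact (h36 : 𝒢.Prop36Hypotheses)
    (K₁ K₂ : Subgroup ((𝒢.galoisLevelData h36).temperedPi h36.isCountable))
    (hK₁ : IsCompact (K₁ : Set ((𝒢.galoisLevelData h36).temperedPi h36.isCountable)))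
    (hK₂ : IsCompact (K₂ : Set ((𝒢.galoisLevelData h36).temperedPi h36.isCountable)))
    {d : (𝒢.galoisLevelData h36).temperedPi h36.isCountable} (hd₁ : d ∈ K₁) (hd₂ : d ∈ K₂)
    (hK : ¬ IsCompact (((K₁ ⊔ K₂).topologicalClosure :
      Subgroup ((𝒢.galoisLevelData h36).temperedPi h36.isCountable)) :
        Set ((𝒢.galoisLevelData h36).temperedPi h36.isCountable))) :
    ∃ (m : ℕ) (e₀ : ((𝒢.galoisLevelData h36).tree m).Edge),
      ((𝒢.galoisLevelData h36).treeAct h36.isCountable m d).hom.edgeMap e₀ = e₀ ∧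
      ∀ (M : ℕ) (hmM : m ≤ M), ∃ ε : ((𝒢.galoisLevelData h36).tree M).Edge,
        ((𝒢.galoisLevelData h36).treeTrans hmM).edgeMap ε = e₀ ∧
        ((𝒢.galoisLevelData h36).treeAct h36.isCountable M d).hom.edgeMap ε = ε := by
  classical
  let Dg := 𝒢.galoisLevelData h36
  have hc := h36.isCountable
  let D₀ : VerticialLevelData.{0} 𝒢 (𝒢.temperedPiChart h36) := verticialLevelData_temperedPiChart (h36 := h36)
  -- some level `m` without a common fixed vertex
  obtain ⟨m, hm⟩ : ∃ m : ℕ, ∀ z : (Dg.tree m).Vertex,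
      (∀ k ∈ K₁, (Dg.treeAct hc m k).hom.vertexMap z = z) → ¬ ∀ k ∈ K₂, (Dg.treeAct hc m k).hom.vertexMap z = z := by
    by_contra h
    push Not at h
    exact hK (isCompact_topologicalClosure_sup_of_forall_exists_common_fixed_vertex h36 K₁ K₂
      fun m => by obtain ⟨z, hz₁, hz₂⟩ := h m; exact ⟨z, hz₁, hz₂⟩)
  obtain ⟨e₀, he₀d, he₀⟩ :=
    exists_fixed_edge_over_on_path_of_forall_not_common_fixed h36 K₁ K₂ hK₁ hK₂ hd₁ hd₂ m hm
  refine ⟨m, e₀, he₀d, fun M hmM => ?_⟩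
  obtain ⟨v, hv⟩ := D₀.exists_forall_mem_fixed_vertex_of_isCompact K₁ hK₁ M
  obtain ⟨w, hw⟩ := D₀.exists_forall_mem_fixed_vertex_of_isCompact K₂ hK₂ M
  obtain ⟨γ, hγp, -⟩ := ((Dg.isTree_tree M).isTree.connected
    (Sum.inl v : (Dg.tree M).Node) (Sum.inl w)).exists_path_of_dist
  obtain ⟨ε, -, hε, hεfix⟩ := he₀ M hmM v w hv hw γ hγp
  exact ⟨ε, hε, hεfix⟩

end ProfiniteSemiGraph

end Literature.AnabelianGeometry.SemiGraphs

end
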